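import Summits.BirchSwinnertonDyer.BirchSwinnertonDyer.Theorems.GenusKolyvaginAtTwoShaCardDvdPowAtTwoRTRelaxedIndex
import Summits.BirchSwinnertonDyer.BirchSwinnertonDyer.Theorems.GenusKolyvaginAtTwoPowDvdShaCardAtTwoRTHeegnerTwinTamagawaValuation
import Summits.BirchSwinnertonDyer.BirchSwinnertonDyer.Theorems.GenusKolyvaginAtTwoGenusPrimitiveSupplyAtTwoLocalTwoTorsion
import Summits.BirchSwinnertonDyer.BirchSwinnertonDyer.Theorems.GenusKolyvaginAtTwoGenusPrimitiveSupplyAtTwoTwistSelmerTransferDownRat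
import Literature.NumberTheory.EllipticCurves.ShaCorestrictionIndexTwo
import HarnessLib

/-!
# Route `GenusKolyvaginAtTwo`, crux U_T `ShaCardDvdPowAtTwoRT` (stmt-BirchSwinnertonDyer-23658), LINE 19 `rational_pair_descent`,
# stub SANDWICH′ input (R): the `Ш`-LEVEL RELAXED INDEX `#res⁻¹(Ш(E/K)[2^∞]) ∣ #Ш(E/ℚ)[2^∞] · ∏_{q ∣ c} #H¹(ℚ_q, E)[2]`

Seat `bsd-line-gk2-p3` g26 (PROVER seat 3/3, cell `bsd-f1-sign2`), `--supports stmt-BirchSwinnertonDyer-23658` (helper; closes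
nothing).  THEOREMS ONLY (no definition, no named fact, no `sorry`); standard axioms; unconditional.  BSD is NOT proved by any of
this; neither is U_T nor any stub.

WHY (LEAD gk2-p1 g19, cell bus 2026-08-29T22:41:32Z, input (R) of SANDWICH′ `stub_sandwichOfMinimalTwin`): with
`X := Ш(E/K)[2^∞] ⊂ H¹(K, E_K)` and `res : H¹(ℚ, E) → H¹(K, E_K)`, the LEAD's count `#X = #X^τ · #(1−τ)X`, `X^τ ⊂ res(res⁻¹X)`
needs `#res⁻¹(X) ≤ #Ш(E/ℚ)[2^∞] · 2^{DEF}`.  This file is the `Ш`-level twin of this seat's (B2) `…RTRelaxedIndex` (p748123, the same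
count for `H¹(ℚ, E[n])`-Selmer groups): a class `b ∈ H¹(ℚ, E)` with `res b ∈ Ш(E/K)` dies in `H¹(K_w, E)` at every `w`
(`mem_localRestrictionKer_iff_resBaseChange_mem`), hence in `H¹(ℚ_v, E)` at every finite `v ∤ c` (GOOD `v ∤ c`: the local extension is
fixed by inertia, Lang–Mazur, `mem_localRestrictionKer_of_tower_of_inertia_le_finGalSubgroup`; BAD `v`: `c` is a square in `ℚ_v`,
degree-one tower) and at `∞` (`Δ < 0`), while `2b` dies everywhere (`cor ∘ res` on `[K_w : ℚ_v] ≤ 2`); so `b ↦ (loc_q b)_{q ∈ D}` maps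
`res⁻¹(X)` into `∏_{q ∈ D} H¹(ℚ_q, E)[2]` with kernel `res⁻¹(X) ∩ Ш(E/ℚ) ⊂ Ш(E/ℚ)[2^∞]` (`cor (res b) = 2b`,
`corBaseChange_resBaseChange`).  `K = ℚ(θ)`, `θ² = c = 1 + 4d` (on the habitat `c = d_K` odd), `D ⊇ {q : q ∣ c}`.

* §1 the two `H¹(F, E)`-level local descents (degree-one tower; good place off `c` along `F(√c)/F`, `c ≡ 1 mod 4`); §2 over `ℚ`:
  `b` dies off `c`, `2b` dies everywhere, `2·res⁻¹(Ш_K) ⊂ Ш_ℚ` on `Δ < 0`, `ker res` is `2`-torsion.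
* §3 **`natCard_comap_resBaseChange_shaPrimary_dvd`** — **(R): `#res⁻¹(Ш(E/K)[2^∞]) ∣ #Ш(E/ℚ)[2^∞] · ∏_{q ∈ D} #H¹(ℚ_q, E)[2]`**
  in the LEAD's currency `((primaryComponent (W⁄K).sha 2).map sha.subtype).comap (resBaseChange W K)`; and the points form
  **`natCard_comap_resBaseChange_shaPrimary_dvd_tors`**: `… ∣ #Ш(E/ℚ)[2^∞] · ∏_{q ∈ D} #E(ℚ_q)[2]` for `D` of odd places (local Tate
  duality, `LocalDualityOrder.natCard_torsionBy_localH1_eq_of_not_mem`).  (On U_T's frame with `C(W)` odd, `∏_{q ∣ d_K} #E(ℚ_q)[2] =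
  2^{ord₂ C(Wd)}` is this seat's g17 `prod_ncard_roots_add_one_eq_two_pow_padicValNat_tamagawaProduct_twin`.)
* §4 **`natCard_comap_resBaseChange_shaPrimary_dvd_two_pow_onFrame`** — (R) IN THE LEAD'S EXACT SHAPE on U_T's frame:
  `#res⁻¹(Ш(E/K)[2^∞]) ∣ #Ш(E/ℚ)[2^∞] · 2^{ord₂ C(Wd)}` for `W/ℚ` globally minimal with `Δ < 0` and `C(W)` odd, `K` imaginary quadratic
  with odd `d_K`, Heegner for `N_W`, `σ₀ ≠ 1`, and ANY model `Wd = Cd • W^{(d_K)}` of the twin (the places of `d_K` as `D`; the dictionary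
  `#E(ℚ_q)[2] = #roots_q + 1`, `natCard_ker_two_adicCompletion_eq_ncard_roots_add_one`).

References: [Kramer1981] §2 Prop. 3, §4 (13); [MilneADT2006] I §3, §6; [McCallumLMS1991] §4 Lemma 4.3; [Mazur1972] Cor. 4.4.
-/

set_option autoImplicit false
set_option linter.dupNamespace false -- `Summit.<P>.<Sub>` repeats `BirchSwinnertonDyer` (D-0017)

noncomputable section

open scoped Classical

universe u

namespace Summit.BirchSwinnertonDyer.BirchSwinnertonDyer.Theorems.GenusExact.SelmerDescent

open WeierstrassCurve NumberField IsDedekindDomain Field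
open Literature.NumberTheory.EllipticCurves Literature.NumberTheory.GaloisRepresentations
open Summit.BirchSwinnertonDyer.BirchSwinnertonDyer.Theorems.GenusExact.ArchVanishing

/-! ## §1 Two `H¹(F, E)`-level local descents -/

section General

variable {F : Type u} [Field F] [NumberField F] (W : WeierstrassCurve F) [W.IsElliptic]
variable (L : Type u) [Field L] [NumberField L] [Algebra F L]
variable (v : HeightOneSpectrum (𝓞 F)) (w : HeightOneSpectrum (𝓞 L)) [w.asIdeal.LiesOver v.asIdeal]

omit [W.IsElliptic] in
/-- **Degree-one tower: `[L_w : F_v] = 1` ⟹ a class of `H¹(F, E)` dying over `L_w` dies over `F_v`** (any place, any reduction).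
[cite: SerreGaloisCohomology1997, I §2.4 (Cor. to Prop. 9)] -/
theorem mem_localRestrictionKer_of_tower_of_finrank_eq_one
    (h1 : letI : Algebra (v.adicCompletion F) (w.adicCompletion L) :=
        (adicCompletionMap (K := F) L v w).toAlgebra
      Module.finrank (v.adicCompletion F) (w.adicCompletion L) = 1)
    {b : W.galH1} (hb : b ∈ W.localRestrictionKer (w.adicCompletion L)) :
    b ∈ W.localRestrictionKer (v.adicCompletion F) := by
  letI : Algebra (v.adicCompletion F) (w.adicCompletion L) := (adicCompletionMap (K := F) L v w).toAlgebra
  obtain ⟨hfin, -⟩ := finrank_adicCompletion_le_of_liesOver L v w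
  haveI : FiniteDimensional (v.adicCompletion F) (w.adicCompletion L) := hfin
  haveI : IsScalarTower F (v.adicCompletion F) (w.adicCompletion L) :=
    IsScalarTower.of_algebraMap_eq fun x ↦ (adicCompletionMap_coe (K := F) L v w x).symm
  haveI : CharZero (v.adicCompletion F) :=
    charZero_of_injective_algebraMap (algebraMap F (v.adicCompletion F)).injective
  have h := index_nsmul_mem_localRestrictionKer_of_tower W (E := v.adicCompletion F) hb
  have hidx : (finGalSubgroup (E := v.adicCompletion F) (w.adicCompletion L)).index = 1 := by
    haveI : IsGalois (v.adicCompletion F) (w.adicCompletion L) :=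
      isGalois_of_finrank_le_two (E := v.adicCompletion F) (w.adicCompletion L) (by omega)
    rw [index_finGalSubgroup_eq, finrank_finGaloisClosure_eq, h1]
  rwa [hidx, one_nsmul] at h

/-- **Good place off `c` along `L = F(√c)`, `c ≡ 1 (mod 4)`: a class of `H¹(F, E)` dying over `L_w` dies over `F_v`** (`E` good at
`v ∤ c`; the local extension `L_w/F_v` is fixed by the inertia group, and `H¹(F_v^{nr}/F_v, E) = 0` at good reduction — Lang–Mazur;
any residue characteristic, also `v ∣ 2`).  [cite: MilneADT2006, I Prop. 3.8] [cite: Mazur1972, Cor. 4.4] [cite: McCallumLMS1991, §4 Lemma 4.3] -/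
theorem mem_localRestrictionKer_of_tower_of_sq_eq_one_add_four_mul {θ : L} (hθ : Algebra.adjoin F {θ} = ⊤)
    {c d : 𝓞 F} (hcd : c = 1 + 4 * d) (hc : θ ^ 2 = algebraMap (𝓞 F) L c) (hgood : W.HasGoodReductionAt v)
    (hcv : c ∉ v.asIdeal) {b : W.galH1} (hb : b ∈ W.localRestrictionKer (w.adicCompletion L)) :
    b ∈ W.localRestrictionKer (v.adicCompletion F) := by
  letI : Algebra (v.adicCompletion F) (w.adicCompletion L) := (adicCompletionMap (K := F) L v w).toAlgebra
  obtain ⟨hfin, -⟩ := finrank_adicCompletion_le_of_liesOver L v w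
  haveI : FiniteDimensional (v.adicCompletion F) (w.adicCompletion L) := hfin
  haveI : IsScalarTower F (v.adicCompletion F) (w.adicCompletion L) :=
    IsScalarTower.of_algebraMap_eq fun x ↦ (adicCompletionMap_coe (K := F) L v w x).symm
  obtain ⟨𝔐, h𝔐⟩ := v.localPrimesAbove_nonempty
  exact mem_localRestrictionKer_of_tower_of_inertia_le_finGalSubgroup W v (w.adicCompletion L) hgood h𝔐
    (localInertia_le_finGalSubgroup_of_sq_eq_one_add_four_mul L v w hθ hcd hc hcv h𝔐) hb

end General

/-! ## §2 Over `ℚ` with `K = ℚ(√c)`, `c ≡ 1 (mod 4)`: classes whose restriction lies in `Ш(E/K)` -/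

section Rat

variable {K : Type} [Field K] [NumberField K] (W : WeierstrassCurve ℚ) [W.IsElliptic]

/-- **`res b ∈ Ш(E/K)` ⟹ `b` dies in `H¹(ℚ_v, E)` at every finite `v ∤ c`** (`K = ℚ(θ)`, `θ² = c = 1 + 4d`; every bad place of `E`
has `c ∈ (ℚ_v^×)²` — on the habitat: Heegner): `res b` dies over `K_w` (`w ∣ v`), and `K_w/ℚ_v` is of degree one (bad `v`, `c` square)
or `E` is good at `v ∤ c` (§1).  [cite: McCallumLMS1991, §4 Lemma 4.3] [cite: MilneADT2006, I Prop. 3.8 and I §6] -/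
theorem mem_localRestrictionKer_of_resBaseChange_mem_sha (h2 : Module.finrank ℚ K = 2) {θ : K}
    (hθ : θ ∉ (algebraMap ℚ K).range) {c d : ℤ} (hcd : c = 1 + 4 * d) (hc : θ ^ 2 = algebraMap ℚ K c)
    (hbad : ∀ v : HeightOneSpectrum (𝓞 ℚ), ¬ W.HasGoodReductionAt v →
      ∃ s : v.adicCompletion ℚ, s ^ 2 = algebraMap ℚ (v.adicCompletion ℚ) c)
    {b : W.galH1} (hb : resBaseChange W K b ∈ (W.baseChange K).sha) (v : HeightOneSpectrum (𝓞 ℚ))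
    (hcv : ((c : ℤ) : 𝓞 ℚ) ∉ v.asIdeal) : b ∈ W.localRestrictionKer (v.adicCompletion ℚ) := by
  obtain ⟨w, hw⟩ := exists_liesOver K v
  have hbw : b ∈ W.localRestrictionKer (w.adicCompletion K) :=
    (mem_localRestrictionKer_iff_resBaseChange_mem W _).mpr ((((W.baseChange K).mem_sha_iff _).mp hb).1 w)
  by_cases hgood : W.HasGoodReductionAt v
  · have hcd' : ((c : ℤ) : 𝓞 ℚ) = 1 + 4 * ((d : ℤ) : 𝓞 ℚ) := by rw [hcd]; push_cast; ring
    have hc' : θ ^ 2 = algebraMap (𝓞 ℚ) K ((c : ℤ) : 𝓞 ℚ) := by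
      rw [hc, IsScalarTower.algebraMap_apply (𝓞 ℚ) ℚ K, map_intCast, map_intCast, map_intCast]
    exact mem_localRestrictionKer_of_tower_of_sq_eq_one_add_four_mul W K v w
      (adjoin_simple_eq_top_of_finrank_eq_two h2 hθ) hcd' hc' hgood hcv hbw
  · exact mem_localRestrictionKer_of_tower_of_finrank_eq_one W K v w
      (finrank_adicCompletion_eq_one_of_sq h2 hθ hc v w (hbad v hgood)) hbw

omit [W.IsElliptic] in
/-- **`res b ∈ Ш(E/K)` ⟹ `2b` dies in `H¹(ℚ_v, E)` at EVERY finite `v`** (`[K_w : ℚ_v] ≤ 2`, `cor ∘ res`).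
[cite: SerreGaloisCohomology1997, I §2.4 (Cor. to Prop. 9)] [cite: McCallumLMS1991, §4 Lemma 4.3] -/
theorem two_nsmul_mem_localRestrictionKer_of_resBaseChange_mem_sha (h2 : Module.finrank ℚ K = 2)
    {b : W.galH1} (hb : resBaseChange W K b ∈ (W.baseChange K).sha) (v : HeightOneSpectrum (𝓞 ℚ)) :
    2 • b ∈ W.localRestrictionKer (v.adicCompletion ℚ) := by
  obtain ⟨w, hw⟩ := exists_liesOver K v
  have hbw : b ∈ W.localRestrictionKer (w.adicCompletion K) :=
    (mem_localRestrictionKer_iff_resBaseChange_mem W _).mpr ((((W.baseChange K).mem_sha_iff _).mp hb).1 w)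
  exact two_nsmul_mem_localRestrictionKer_of_finrank_le_two W K v w h2.le hbw

/-- **On `Δ(E) < 0`: `res b ∈ Ш(E/K)` ⟹ `2b ∈ Ш(E/ℚ)`** (finite places by the previous lemma; the real place carries no condition,
`localRestrictionKer_infinitePlace_eq_top_of_Δ_neg`).  [cite: SerreGaloisCohomology1997, I §2.4] [cite: MilneADT2006, I §6] -/
theorem two_nsmul_mem_sha_of_resBaseChange_mem_sha (h2 : Module.finrank ℚ K = 2) (hΔ : W.Δ < 0)
    {b : W.galH1} (hb : resBaseChange W K b ∈ (W.baseChange K).sha) : 2 • b ∈ W.sha := by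
  rw [mem_sha_iff]
  refine ⟨fun v ↦ two_nsmul_mem_localRestrictionKer_of_resBaseChange_mem_sha W h2 hb v, fun w ↦ ?_⟩
  rw [localRestrictionKer_infinitePlace_eq_top_of_Δ_neg W w hΔ]
  trivial

omit [W.IsElliptic] in
/-- **The kernel of `res : H¹(ℚ, E) → H¹(K, E_K)` is `2`-torsion** for a quadratic `K` (`cor (res b) = 2b`, the tree's
`corBaseChange_resBaseChange`; `σ₀ ≠ 1` in `Aut(K/ℚ)`).  [cite: SerreGaloisCohomology1997, I §2.4 (Prop. 9)] -/
theorem two_nsmul_eq_zero_of_resBaseChange_eq_zero (h2 : Module.finrank ℚ K = 2) {σ₀ : K ≃ₐ[ℚ] K} (hσ₀ : σ₀ ≠ 1)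
    {b : W.galH1} (hb : resBaseChange W K b = 0) : 2 • b = 0 := by
  rw [← corBaseChange_resBaseChange K W σ₀ h2 hσ₀ b, hb, map_zero]

end Rat

/-! ## §3 (R): the `Ш`-level relaxed index -/

section RelaxedSha

variable {K : Type} [Field K] [NumberField K] (W : WeierstrassCurve ℚ) [W.IsElliptic]

omit [W.IsElliptic] in
/-- Membership in the LEAD's `res⁻¹(Ш(E/K)[2^∞])`: `res b ∈ Ш(E/K)` and `2^k · res b = 0` for some `k`. [folklore] -/
theorem mem_comap_resBaseChange_shaPrimary_iff (b : W.galH1) :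
    b ∈ ((AddCommGroup.primaryComponent (W.baseChange K).sha 2).map (W.baseChange K).sha.subtype).comap (resBaseChange W K) ↔
      resBaseChange W K b ∈ (W.baseChange K).sha ∧ ∃ k : ℕ, 2 ^ k • resBaseChange W K b = 0 := by
  rw [AddSubgroup.mem_comap, AddSubgroup.mem_map]
  constructor
  · rintro ⟨x, hx, hxb⟩
    obtain ⟨n, h0⟩ := (AddCommGroup.mem_primaryComponent).mp hx
    refine ⟨?_, n, ?_⟩
    · rw [← hxb]; exact x.2
    · rw [← hxb, AddSubgroup.coe_subtype, ← AddSubgroupClass.coe_nsmul, h0, ZeroMemClass.coe_zero]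
  · rintro ⟨hsha, k, hk⟩
    refine ⟨⟨resBaseChange W K b, hsha⟩, ?_, rfl⟩
    apply (AddCommGroup.mem_primaryComponent).mpr
    exact ⟨k, Subtype.ext (by rw [AddSubgroupClass.coe_nsmul, ZeroMemClass.coe_zero]; exact hk)⟩

/-- **(R) THE `Ш`-LEVEL RELAXED INDEX: `#res⁻¹(Ш(E/K)[2^∞]) ∣ #Ш(E/ℚ)[2^∞] · ∏_{q ∈ D} #H¹(ℚ_q, E)[2]`.**  `E = W/ℚ` elliptic with
`Δ < 0`; `K = ℚ(θ)` quadratic, `θ² = c = 1 + 4d ∈ ℤ`, `σ₀ ≠ 1` in `Aut(K/ℚ)`; every bad place of `E` has `c ∈ (ℚ_v^×)²`; `D` a finite set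
of finite places containing those dividing `c`.  The map `b ↦ (loc_q b)_{q ∈ D}` sends `res⁻¹(Ш(E/K)[2^∞]) ⊂ H¹(ℚ, E)` into
`∏_{q ∈ D} H¹(ℚ_q, E)[2]` (§2) with kernel inside `Ш(E/ℚ)[2^∞]` (`b` locally trivial off `D` by §2 and on `D` by assumption; `2^k res b = 0
⟹ 2^{k+1} b = 0`).  All cardinalities `Nat.card` (a would-be infinite factor reads `∣ 0`).  [cite: Kramer1981, §2 Prop. 3 and §4 (13)]
[cite: MilneADT2006, I §6] [cite: SerreGaloisCohomology1997, I §2.4] -/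
theorem natCard_comap_resBaseChange_shaPrimary_dvd (h2 : Module.finrank ℚ K = 2) {σ₀ : K ≃ₐ[ℚ] K} (hσ₀ : σ₀ ≠ 1)
    {θ : K} (hθ : θ ∉ (algebraMap ℚ K).range) {c d : ℤ} (hcd : c = 1 + 4 * d) (hc : θ ^ 2 = algebraMap ℚ K c)
    (hΔ : W.Δ < 0)
    (hbad : ∀ v : HeightOneSpectrum (𝓞 ℚ), ¬ W.HasGoodReductionAt v →
      ∃ s : v.adicCompletion ℚ, s ^ 2 = algebraMap ℚ (v.adicCompletion ℚ) c)
    (D : Finset (HeightOneSpectrum (𝓞 ℚ))) (hD : ∀ q : HeightOneSpectrum (𝓞 ℚ), ((c : ℤ) : 𝓞 ℚ) ∈ q.asIdeal → q ∈ D) :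
    Nat.card (((AddCommGroup.primaryComponent (W.baseChange K).sha 2).map (W.baseChange K).sha.subtype).comap
        (resBaseChange W K)) ∣
      Nat.card (AddCommGroup.primaryComponent W.sha 2) *
        ∏ q ∈ D, Nat.card (AddSubgroup.torsionBy (W.localH1 (q.adicCompletion ℚ)) (2 : ℤ)) := by
  set R := ((AddCommGroup.primaryComponent (W.baseChange K).sha 2).map (W.baseChange K).sha.subtype).comap
    (resBaseChange W K) with hR
  have hmemR : ∀ b : R, resBaseChange W K (b : W.galH1) ∈ (W.baseChange K).sha ∧
      ∃ k : ℕ, 2 ^ k • resBaseChange W K (b : W.galH1) = 0 :=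
    fun b ↦ (mem_comap_resBaseChange_shaPrimary_iff W (b : W.galH1)).mp b.2
  -- `loc_q b` is `2`-torsion for `b ∈ R`
  have h2loc : ∀ (b : R) (q : D), (2 : ℤ) • W.localRestrictionHom ((q : HeightOneSpectrum (𝓞 ℚ)).adicCompletion ℚ)
      (b : W.galH1) = 0 := by
    intro b q
    have h := two_nsmul_mem_localRestrictionKer_of_resBaseChange_mem_sha W h2 (hmemR b).1 q
    rw [mem_localRestrictionKer_iff, map_nsmul] at h
    rwa [two_zsmul, ← two_nsmul]
  let Φ : R →+ ((q : D) → AddSubgroup.torsionBy (W.localH1 ((q : HeightOneSpectrum (𝓞 ℚ)).adicCompletion ℚ)) (2 : ℤ)) :=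
    { toFun := fun b q => ⟨_, h2loc b q⟩
      map_zero' := by
        funext q
        ext
        simp
      map_add' := fun x y => by
        funext q
        ext
        simp }
  have hker_le : Φ.ker.map R.subtype ≤ (AddCommGroup.primaryComponent W.sha 2).map W.sha.subtype := by
    rintro _ ⟨b, hb0, rfl⟩
    have hb0' : ∀ q : D, W.localRestrictionHom ((q : HeightOneSpectrum (𝓞 ℚ)).adicCompletion ℚ) (b : W.galH1) = 0 := by
      intro q
      have := congrArg (fun f => ((f q : AddSubgroup.torsionBy _ (2 : ℤ)) :
        W.localH1 ((q : HeightOneSpectrum (𝓞 ℚ)).adicCompletion ℚ))) (AddMonoidHom.mem_ker.mp hb0)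
      simpa [Φ] using this
    have hbsha : (b : W.galH1) ∈ W.sha := by
      rw [mem_sha_iff]
      refine ⟨fun v ↦ ?_, fun w ↦ ?_⟩
      · by_cases hcv : ((c : ℤ) : 𝓞 ℚ) ∈ v.asIdeal
        · rw [mem_localRestrictionKer_iff]
          exact hb0' ⟨v, hD v hcv⟩
        · exact mem_localRestrictionKer_of_resBaseChange_mem_sha W h2 hθ hcd hc hbad (hmemR b).1 v hcv
      · rw [localRestrictionKer_infinitePlace_eq_top_of_Δ_neg W w hΔ]
        trivial
    obtain ⟨-, k, hk⟩ := hmemR b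
    have h2k : 2 ^ (k + 1) • (b : W.galH1) = 0 := by
      have hres0 : resBaseChange W K (2 ^ k • (b : W.galH1)) = 0 := by rw [map_nsmul, hk]
      have h := two_nsmul_eq_zero_of_resBaseChange_eq_zero W h2 hσ₀ hres0
      rwa [smul_smul, ← pow_succ'] at h
    refine ⟨⟨(b : W.galH1), hbsha⟩, ?_, rfl⟩
    apply (AddCommGroup.mem_primaryComponent).mpr
    exact ⟨k + 1, Subtype.ext (by rw [AddSubgroupClass.coe_nsmul, ZeroMemClass.coe_zero]; exact h2k)⟩
  have hker : Nat.card Φ.ker ∣ Nat.card (AddCommGroup.primaryComponent W.sha 2) := by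
    rw [Nat.card_congr (AddSubgroup.equivMapOfInjective Φ.ker R.subtype Subtype.coe_injective).toEquiv,
      Nat.card_congr (AddSubgroup.equivMapOfInjective (AddCommGroup.primaryComponent W.sha 2) W.sha.subtype
        Subtype.coe_injective).toEquiv]
    exact AddSubgroup.card_dvd_of_le hker_le
  have hrange : Nat.card Φ.range ∣
      ∏ q ∈ D, Nat.card (AddSubgroup.torsionBy (W.localH1 (q.adicCompletion ℚ)) (2 : ℤ)) := by
    refine (AddSubgroup.card_addSubgroup_dvd_card Φ.range).trans ?_
    rw [Nat.card_pi, ← Finset.prod_coe_sort D]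
  rw [AddSubgroup.card_eq_card_quotient_mul_card_addSubgroup Φ.ker,
    Nat.card_congr (QuotientAddGroup.quotientKerEquivRange Φ).toEquiv, mul_comm]
  exact mul_dvd_mul hker hrange

/-- **(R), points form: `#res⁻¹(Ш(E/K)[2^∞]) ∣ #Ш(E/ℚ)[2^∞] · ∏_{q ∈ D} #E(ℚ_q)[2]`** for `D` a finite set of ODD finite places
containing those dividing `c` (local Tate duality off `2`: `#H¹(ℚ_q, E)[2] = #E(ℚ_q)[2]`, this lineage's
`LocalDualityOrder.natCard_torsionBy_localH1_eq_of_not_mem`).  On U_T's frame (`c = d_K` odd, `D` = the primes of `d_K`, `C(W)` odd) the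
product is `2^{ord₂ C(Wd)}` for any model `Wd` of the twin (g17 `prod_ncard_roots_add_one_eq_two_pow_padicValNat_tamagawaProduct_twin`).
[cite: Kramer1981, §2 Prop. 3 and §4 (13)] [cite: MilneADT2006, I Thm. 3.2 and Lemma 3.3] -/
theorem natCard_comap_resBaseChange_shaPrimary_dvd_tors (h2 : Module.finrank ℚ K = 2) {σ₀ : K ≃ₐ[ℚ] K} (hσ₀ : σ₀ ≠ 1)
    {θ : K} (hθ : θ ∉ (algebraMap ℚ K).range) {c d : ℤ} (hcd : c = 1 + 4 * d) (hc : θ ^ 2 = algebraMap ℚ K c)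
    (hΔ : W.Δ < 0)
    (hbad : ∀ v : HeightOneSpectrum (𝓞 ℚ), ¬ W.HasGoodReductionAt v →
      ∃ s : v.adicCompletion ℚ, s ^ 2 = algebraMap ℚ (v.adicCompletion ℚ) c)
    (D : Finset (HeightOneSpectrum (𝓞 ℚ))) (hD : ∀ q : HeightOneSpectrum (𝓞 ℚ), ((c : ℤ) : 𝓞 ℚ) ∈ q.asIdeal → q ∈ D)
    (hD2 : ∀ q ∈ D, (2 : 𝓞 ℚ) ∉ q.asIdeal) :
    Nat.card (((AddCommGroup.primaryComponent (W.baseChange K).sha 2).map (W.baseChange K).sha.subtype).comap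
        (resBaseChange W K)) ∣
      Nat.card (AddCommGroup.primaryComponent W.sha 2) *
        ∏ q ∈ D, Nat.card (nsmulAddMonoidHom (2 ^ 1) :
          (W.baseChange (q.adicCompletion ℚ)).toAffine.Point →+ _).ker := by
  have h := natCard_comap_resBaseChange_shaPrimary_dvd W h2 hσ₀ hθ hcd hc hΔ hbad D hD
  refine h.trans (dvd_of_eq ?_)
  congr 1
  refine Finset.prod_congr rfl fun q hq ↦ ?_
  have hloc := LocalDualityOrder.natCard_torsionBy_localH1_eq_of_not_mem q W (p := 2) (k := 1) one_ne_zero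
    (by exact_mod_cast hD2 q hq)
  change Nat.card (AddSubgroup.torsionBy (W.localH1 (q.adicCompletion ℚ)) ((2 ^ 1 : ℕ) : ℤ)) = _ at hloc
  rw [← hloc]
  norm_num

end RelaxedSha

/-! ## §4 (R) on U_T's frame: the places of `d_K`, `∏_{q ∣ d_K} #E(ℚ_q)[2] = 2^{ord₂ C(Wd)}` -/

section Frame

open Rat.HeightOneSpectrum (primesEquiv natGenerator)
open Literature.NumberTheory.DiophantineGeometry.UniformABCConjecture (natCast_mem_asIdeal_iff)

variable {K : Type} [Field K] [NumberField K] (W : WeierstrassCurve ℚ) [W.IsElliptic] [W.IsGloballyMinimal]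

/-- **`#E(ℚ_v)[2] = #{x̄ ∈ 𝔽_p : ψ(x̄) = 0} + 1`** at a finite place `v` of `ℚ` over an odd prime `p ∤ Δ_min(W)` (`W` globally minimal), in
the `adicCompletion`/`nsmulAddMonoidHom (2^1)` currency of §3 (gk2-p5's `GenusKolyTwin.natCard_twoTorsion_padic_eq` through the place transport
`GenusKolyTwistLocal.natCard_ker_nsmul_adicCompletion_eq_padic`).  [cite: SilvermanAEC2009, VII.3 Prop. 3.1(b)] [cite: MazurRubin2010, Lemma 2.2 (i)] -/
theorem natCard_ker_two_adicCompletion_eq_ncard_roots_add_one (v : HeightOneSpectrum (𝓞 ℚ))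
    (hp2 : ((primesEquiv v : Nat.Primes) : ℕ) ≠ 2) (hpΔ : ¬ (((primesEquiv v : Nat.Primes) : ℕ) : ℤ) ∣ minimalDiscriminantInt W) :
    Nat.card (nsmulAddMonoidHom (2 ^ 1) : (W.baseChange (v.adicCompletion ℚ)).toAffine.Point →+ _).ker =
      {x : ZMod ((primesEquiv v : Nat.Primes) : ℕ) | 4 * x ^ 3 + ((integralModelInt W).b₂ : ZMod ((primesEquiv v : Nat.Primes) : ℕ)) * x ^ 2 +
        2 * ((integralModelInt W).b₄ : ZMod ((primesEquiv v : Nat.Primes) : ℕ)) * x +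
          ((integralModelInt W).b₆ : ZMod ((primesEquiv v : Nat.Primes) : ℕ)) = 0}.ncard + 1 := by
  haveI := Fact.mk (primesEquiv v).2
  rw [GenusKolyTwistLocal.natCard_ker_nsmul_adicCompletion_eq_padic W v (2 ^ 1), pow_one]
  exact GenusKolyTwin.natCard_twoTorsion_padic_eq W hp2 hpΔ

/-- **(R) ON U_T's FRAME, THE LEAD'S SHAPE: `#res⁻¹(Ш(E/K)[2^∞]) ∣ #Ш(E/ℚ)[2^∞] · 2^{ord₂ C(Wd)}`.**  `W/ℚ` globally minimal elliptic with
`Δ_W < 0` and `C(W)` odd; `K` imaginary quadratic with odd `d_K` (so `d_K ≡ 1 mod 4`, `K = ℚ(√d_K)`), Heegner for `N_W` (every bad prime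
splits: `d_K` is a square in `ℚ_v`), `σ₀ ≠ 1` in `Aut(K/ℚ)`; `Wd = Cd • W^{(d_K)}` any elliptic model of the twin.  §3 with `D` = the places of
`d_K` (odd), `#E(ℚ_q)[2] = #roots_q + 1`, and `∏_{q ∣ d_K} (#roots_q + 1) = 2^{ord₂ C(Wd)}` (g17).  With `ord₂ C(Wd) ≤ 1` (PAIRCOUNT's
hypothesis; `= 1` on `Δ < 0`): `#res⁻¹(X) ∣ 2·#Ш(E/ℚ)[2^∞]`.  [cite: Kramer1981, §2 Prop. 3 and Thm. 1] [cite: MilneADT2006, I §6]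
[cite: GrossLMS1991, §1 (p. 235)] -/
theorem natCard_comap_resBaseChange_shaPrimary_dvd_two_pow_onFrame (hK : IsImaginaryQuadratic K) {σ₀ : K ≃ₐ[ℚ] K}
    (hσ₀ : σ₀ ≠ 1) (hodd : Odd (discr K)) (hH : SatisfiesHeegnerHypothesis (W.conductorNorm ℤ) K) (hΔ : W.Δ < 0)
    (hTam : Odd W.tamagawaProduct) {Wd : WeierstrassCurve ℚ} [Wd.IsElliptic] (Cd : VariableChange ℚ)
    (hWd : Cd • W.quadraticTwist (discr K : ℚ) = Wd) :
    Nat.card (((AddCommGroup.primaryComponent (W.baseChange K).sha 2).map (W.baseChange K).sha.subtype).comap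
        (resBaseChange W K)) ∣
      Nat.card (AddCommGroup.primaryComponent W.sha 2) * 2 ^ padicValNat 2 Wd.tamagawaProduct := by
  have h2 := hK.1
  obtain ⟨θ, hθ', hθ2⟩ := exists_sq_eq_discr_not_mem_range K h2
  have hθ : θ ∉ (algebraMap ℚ K).range := by
    rintro ⟨a, ha⟩
    exact hθ' ⟨a, ha⟩
  have hd4 : discr K % 4 = 1 := Literature.NumberTheory.QuadraticFields.Quadratic.discr_emod_four_eq_one hK.1 hodd
  have hcd : discr K = 1 + 4 * (discr K / 4) := by omega
  have hbad : ∀ v : HeightOneSpectrum (𝓞 ℚ), ¬ W.HasGoodReductionAt v →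
      ∃ s : v.adicCompletion ℚ, s ^ 2 = algebraMap ℚ (v.adicCompletion ℚ) ((discr K : ℤ) : ℚ) := fun v hv ↦
    GenusKolyTwistLocal.exists_sq_eq_discr_adicCompletion_of_ncard_primesOver h2 v
      (hH _ (primesEquiv v).2 ((W.dvd_conductorNorm_iff v).mpr hv))
  -- `D` = the places over the primes of `d_K`
  have hd0 : discr K ≠ 0 := NumberField.discr_ne_zero K
  set P : Finset ℕ := (discr K).natAbs.primeFactors with hP
  have hPmem : ∀ q : ℕ, q ∈ P ↔ q.Prime ∧ (q : ℤ) ∣ discr K := by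
    intro q
    rw [hP, Nat.mem_primeFactors, Int.natCast_dvd]
    exact ⟨fun h ↦ ⟨h.1, h.2.1⟩, fun h ↦ ⟨h.1, h.2, Int.natAbs_ne_zero.mpr hd0⟩⟩
  have hPodd : ∀ q : ℕ, q ∈ P → q ≠ 2 := by
    rintro q hq rfl
    exact (Int.not_even_iff_odd.mpr hodd) (even_iff_two_dvd.mpr (by exact_mod_cast ((hPmem 2).mp hq).2))
  let h : {q // q ∈ P} → HeightOneSpectrum (𝓞 ℚ) := fun q ↦
    (primesEquiv (R := 𝓞 ℚ)).symm ⟨q.1, ((hPmem q.1).mp q.2).1⟩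
  have hh : ∀ q : {q // q ∈ P}, primesEquiv (h q) = ⟨q.1, ((hPmem q.1).mp q.2).1⟩ := fun q ↦
    Equiv.apply_symm_apply _ _
  have hinj : Function.Injective h := by
    intro a b hab
    have := congrArg (fun v ↦ ((primesEquiv v : Nat.Primes) : ℕ)) hab
    simp only [hh] at this
    exact Subtype.ext this
  set D : Finset (HeightOneSpectrum (𝓞 ℚ)) := P.attach.image h with hD
  have hDmem : ∀ q : HeightOneSpectrum (𝓞 ℚ), ((discr K : ℤ) : 𝓞 ℚ) ∈ q.asIdeal → q ∈ D := by
    intro q hq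
    have hnat : (((discr K).natAbs : ℕ) : 𝓞 ℚ) ∈ q.asIdeal := by
      rcases Int.natAbs_eq (discr K) with h' | h'
      · rw [h', Int.cast_natCast] at hq
        exact hq
      · rw [h', Int.cast_neg, Int.cast_natCast] at hq
        exact neg_mem_iff.mp hq
    have hdvd : natGenerator q ∣ (discr K).natAbs := (natCast_mem_asIdeal_iff q _).mp hnat
    have hqP : natGenerator q ∈ P :=
      Nat.mem_primeFactors.mpr ⟨Rat.HeightOneSpectrum.prime_natGenerator q, hdvd, Int.natAbs_ne_zero.mpr hd0⟩
    refine Finset.mem_image.mpr ⟨⟨natGenerator q, hqP⟩, Finset.mem_attach _ _, ?_⟩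
    change (primesEquiv (R := 𝓞 ℚ)).symm ⟨natGenerator q, _⟩ = q
    exact (Equiv.symm_apply_eq _).mpr rfl
  have hD2 : ∀ q ∈ D, (2 : 𝓞 ℚ) ∉ q.asIdeal := by
    intro q hq
    obtain ⟨a, -, rfl⟩ := Finset.mem_image.mp hq
    have haP : a.1.Prime := ((hPmem a.1).mp a.2).1
    have hav : ((a.1 : ℕ) : 𝓞 ℚ) ∈ (h a).asIdeal := by
      have hmem := Rat.HeightOneSpectrum.natCast_natGenerator_mem (h a)
      have hgen : natGenerator (h a) = a.1 := congrArg (fun x : Nat.Primes ↦ (x : ℕ)) (hh a)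
      rwa [hgen] at hmem
    have h2' := GenusKolyTwistingPrime.natCast_not_mem_of_not_dvd haP hav fun h2a ↦
      hPodd a.1 a.2 ((Nat.prime_dvd_prime_iff_eq haP Nat.prime_two).mp h2a)
    exact_mod_cast h2'
  have hmain := natCard_comap_resBaseChange_shaPrimary_dvd_tors W h2 hσ₀ hθ hcd hθ2 hΔ hbad D hDmem hD2
  refine hmain.trans (dvd_of_eq ?_)
  congr 1
  rw [hD, Finset.prod_image fun a _ b _ hab ↦ hinj hab,
    ← PlusDescent.prod_ncard_roots_add_one_eq_two_pow_padicValNat_tamagawaProduct_twin W hK hodd hH hTam Cd hWd,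
    ← Finset.prod_attach P]
  refine Finset.prod_congr rfl fun a _ ↦ ?_
  obtain ⟨haP, hadvd⟩ := (hPmem a.1).mp a.2
  have ha2 : a.1 ≠ 2 := hPodd a.1 a.2
  have haΔ : ¬ (a.1 : ℤ) ∣ minimalDiscriminantInt W :=
    PlusDescent.not_dvd_minimalDiscriminantInt_of_dvd_discr_of_heegner W K h2 hH haP ha2 hadvd
  have hgen : ((primesEquiv (h a) : Nat.Primes) : ℕ) = a.1 := congrArg (fun x : Nat.Primes ↦ (x : ℕ)) (hh a)
  rw [natCard_ker_two_adicCompletion_eq_ncard_roots_add_one W (h a) (by rw [hgen]; exact ha2) (by rw [hgen]; exact haΔ), hgen]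

end Frame

end Summit.BirchSwinnertonDyer.BirchSwinnertonDyer.Theorems.GenusExact.SelmerDescent

end
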